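import Literature.AlgebraicGeometry.Resolution.PointBlowupKangaroo
import Literature.AlgebraicGeometry.Resolution.PointBlowupShadeCentres
import HarnessLib

/-!
# [OURS · L1 W4.6] Rung (iii) "Moh window" for the classical pair — a FIXED POINT inside the window:
  `x² + y(u + y + uy)²` repeats identically under a point blow-up (characteristic `2`)

Cell `res-hironaka`, rung L, slot W4.6, seat `res-L1-s46-pv-6` (gen 2).  The boundary of what rung (iii)
can say for POINT centres in the classical model (`PointBlowup.State/step` of `PointBlowupShade.lean`,
[Hauser2010, §§F–G]): the cleaned state

  `F = u²y + y³ + u²y³ = y·(u + y + uy)²`,  `r = (0, 1)`  (`p = 2`, variables `(y₀, y₁) = (u, y)`),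

of order `3` — INSIDE the window `2 ≤ ord₀ F < 4`, shade `2` — is EQUIMULTIPLE at the point `u = 1`
of the `y`-chart of the blow-up of the origin, and the step of the model there returns THE SAME STATE
(`step_fixedPoint`): chart transform `u²y + y + u²y³`, translation `u ↦ u + 1` gives back `F` in
characteristic `2`, nothing to clean, new multiplicities `(0, 3 − 2) = (0, 1)`.  Hence
(`exists_fixed_point_in_window`) an INFINITE walk of equimultiple point blow-ups inside the Moh window
with constant shade, over every field of characteristic `2` — so:
* gen 0's no-increase law (`CampaignW46MohWindowShadeAntitone`, desk #35) is inhabited by infinite walks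
  (lane-B note «`∀ n` equimultiplicity = infinite walks only»: such walks exist) and is the most a
  statement about ARBITRARY equimultiple point sequences inside the window can assert — no termination;
* the terminal-case and bottom-edge termination theorems of gen 2 (`…ShadeTerminal`, `…ShadeExit`,
  `…ShadeTerminalCentres[Exit]`) do not extend to all in-window states of the coordinate-bound model:
  here NO positive-dimensional COORDINATE centre is permissible (`ordAlong_axis_lt`: both axes have
  `ord_{C} F < 2`), while the `2`-fold locus of `x² + y(u + y + uy)²` is the smooth NON-coordinate curve
  `{x = 0, u + y + uy = 0}` — in the parameters `(y, u + y + uy)` the state is the monomial case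
  `y · ũ²` of [HauserPerlega2024, §3], resolved by blowing up that curve.  The atlas rule (point or
  coordinate centre) cycles; resolution does not.
Found by the seat's Python twin of the engine (cell dir `L/res-L1-s46-pv-6/py/cycle3.py`), proved here
over every field of characteristic `2`.  OURS; a NEGATIVE-SIDE calibration fact for regime (iii) of
RESCUE-SEED W4.6 in the classical model; NOT a statement of the manuscript [claim: Hironaka2017, status:
under-review], nothing of which is used, and not a claim about resolution of singularities (cf. the
tree's `ResidualOrderUnboundedExample1Cycle` / [HauserPerlega2019Cycles]: cycles under badly chosen
centres).  AI review is weaker than expert review.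
-/

noncomputable section

set_option linter.dupNamespace false -- mandated namespace of this single-conjunct summit

open MvPolynomial Finset

open scoped BigOperators

namespace Summit.ResolutionOfSingularities.ResolutionOfSingularities.Theorems.CampaignW46.MohWindowShadeFixedPoint

open Literature.AlgebraicGeometry.Resolution
open Literature.AlgebraicGeometry.Resolution.PointBlowup
open Literature.AlgebraicGeometry.Resolution.Hauser2010
open Literature.Barriers.ResolutionOfSingularities (ordZero_le_of_coeff_ne_zero le_ordZero_of_forall)

variable (K : Type*) [Field K]

/-- The residual polynomial `F = u²y + y³ + u²y³ = y(u + y + uy)²` (characteristic `2`).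
[OURS · L1 W4.6] -/
def fixedF : MvPolynomial (Fin 2) K := X 0 ^ 2 * X 1 + X 1 ^ 3 + X 0 ^ 2 * X 1 ^ 3

/-- The exceptional multiplicities `r = (0, 1)`: the component `{y = 0}` with multiplicity `1`.
[OURS · L1 W4.6] -/
def fixedMult : Fin 2 →₀ ℕ := Finsupp.single 1 1

/-- exponent `(2, 1)` of `u²y`. [folklore] -/
abbrev e21 : Fin 2 →₀ ℕ := Finsupp.single 0 2 + Finsupp.single 1 1
/-- exponent `(0, 3)` of `y³`. [folklore] -/
abbrev e03 : Fin 2 →₀ ℕ := Finsupp.single 0 0 + Finsupp.single 1 3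
/-- exponent `(2, 3)` of `u²y³`. [folklore] -/
abbrev e23 : Fin 2 →₀ ℕ := Finsupp.single 0 2 + Finsupp.single 1 3

/-- `F` as a sum of three monomials. [folklore] -/
theorem fixedF_eq : fixedF K = monomial e21 1 + monomial e03 1 + monomial e23 1 := by
  unfold fixedF
  rw [← X_pow_mul_X_pow, ← X_pow_mul_X_pow, ← X_pow_mul_X_pow, pow_zero, one_mul, pow_one]

/-- the three exponents are distinct. [folklore] -/
theorem e_ne : (e21 ≠ e03) ∧ (e21 ≠ e23) ∧ (e03 ≠ e23) := by
  refine ⟨single_add_single_ne (by norm_num), ?_, single_add_single_ne (by norm_num)⟩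
  intro h
  have := DFunLike.congr_fun h 1
  simp at this

/-- The support of `F`. [folklore] -/
theorem support_fixedF : (fixedF K).support = {e21, e03, e23} := by
  classical
  obtain ⟨h12, h13, h23⟩ := e_ne
  rw [fixedF_eq]
  ext d
  rw [MvPolynomial.mem_support_iff, coeff_add, coeff_add, coeff_monomial, coeff_monomial, coeff_monomial,
    Finset.mem_insert, Finset.mem_insert, Finset.mem_singleton]
  by_cases h1 : e21 = d
  · subst h1; simp [h12, h13, h12.symm, h13.symm]
  by_cases h2 : e03 = d
  · subst h2; simp [h12, h23, h12.symm, h23.symm]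
  by_cases h3 : e23 = d
  · subst h3; simp [h13, h23, h13.symm, h23.symm]
  simp [h1, h2, h3, Ne.symm h1, Ne.symm h2, Ne.symm h3]

/-- `ord₀ F = 3`: inside the Moh window `[2, 4)` of `p = 2`. [OURS · L1 W4.6] -/
theorem ordZero_fixedF : ordZero (fixedF K) = 3 := by
  classical
  obtain ⟨h12, h13, h23⟩ := e_ne
  apply le_antisymm
  · have : coeff e03 (fixedF K) ≠ 0 := by
      rw [fixedF_eq, coeff_add, coeff_add, coeff_monomial, coeff_monomial, coeff_monomial, if_neg h12,
        if_pos rfl, if_neg (Ne.symm h23)]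
      simp
    have h := ordZero_le_of_coeff_ne_zero _ _ this
    simpa [Finsupp.degree_eq_sum, Fin.sum_univ_two] using h
  · refine le_ordZero_of_forall _ _ fun d hd => ?_
    have hmem : d ∈ (fixedF K).support := MvPolynomial.mem_support_iff.mpr hd
    rw [support_fixedF, Finset.mem_insert, Finset.mem_insert, Finset.mem_singleton] at hmem
    rcases hmem with rfl | rfl | rfl <;> simp [Finsupp.degree_eq_sum, Fin.sum_univ_two]

/-- `y^r ∣ F`: every monomial of `F` is divisible by `y`. [OURS · L1 W4.6] -/
theorem fixedMult_le_of_mem_support : ∀ d ∈ (fixedF K).support, fixedMult ≤ d := by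
  intro d hd
  rw [support_fixedF, Finset.mem_insert, Finset.mem_insert, Finset.mem_singleton] at hd
  rcases hd with rfl | rfl | rfl <;> refine Finsupp.le_def.mpr fun i => ?_ <;> fin_cases i <;>
    simp [fixedMult]

/-- An exponent vector on `Fin 2` with odd second entry is not a square exponent. [folklore] -/
theorem not_isPthPowerExponent_two_of_odd_snd (a : ℕ) {c : ℕ} (hc : c % 2 = 1) :
    ¬ IsPthPowerExponent 2 (Finsupp.single (0 : Fin 2) a + Finsupp.single 1 c) := by
  rw [isPthPowerExponent_iff]
  intro h
  have h1 : (Finsupp.single (0 : Fin 2) a + Finsupp.single 1 c : Fin 2 →₀ ℕ) 1 = c := by simp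
  have := h 1
  rw [h1] at this
  omega

/-- `F` is clean: no monomial of `F` is a square (`y`-exponents `1, 3, 3`). [OURS · L1 W4.6] -/
theorem deletePthPowers_fixedF : deletePthPowers 2 (fixedF K) = fixedF K := by
  rw [fixedF_eq, deletePthPowers_add, deletePthPowers_binomial 2
    (not_isPthPowerExponent_two_of_odd_snd 2 rfl) (not_isPthPowerExponent_two_of_odd_snd 0 rfl),
    deletePthPowers_monomial, if_neg (not_isPthPowerExponent_two_of_odd_snd 2 rfl)]

/-- The shade of the state `(F, (0,1))` is `3 − 1 = 2` (`= p`). [OURS · L1 W4.6] -/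
theorem shade_fixed : (State.mk (fixedF K) fixedMult).shade = 2 := by
  rw [shade_eq_of_ordZero_eq _ (ordZero_fixedF K)]
  simp [fixedMult, Finsupp.degree_eq_sum]

/-- **Chart transform** in the `y`-chart (`u ↦ uy`, division by `y²`): `u²y + y + u²y³`.
[OURS · L1 W4.6] -/
theorem chartTransform_fixedF :
    chartTransform 2 1 (fixedF K) = X 0 ^ 2 * X 1 + X 1 + X 0 ^ 2 * X 1 ^ 3 := by
  classical
  obtain ⟨h12, h13, h23⟩ := e_ne
  have hc1 : coeff e21 (fixedF K) = 1 := by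
    rw [fixedF_eq, coeff_add, coeff_add, coeff_monomial, coeff_monomial, coeff_monomial, if_pos rfl,
      if_neg (Ne.symm h12), if_neg (Ne.symm h13)]; simp
  have hc2 : coeff e03 (fixedF K) = 1 := by
    rw [fixedF_eq, coeff_add, coeff_add, coeff_monomial, coeff_monomial, coeff_monomial, if_neg h12,
      if_pos rfl, if_neg (Ne.symm h23)]; simp
  have hc3 : coeff e23 (fixedF K) = 1 := by
    rw [fixedF_eq, coeff_add, coeff_add, coeff_monomial, coeff_monomial, coeff_monomial, if_neg h13,
      if_neg h23, if_pos rfl]; simp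
  unfold chartTransform
  rw [support_fixedF, Finset.sum_insert (by simp [h12, h13]), Finset.sum_insert (by simp [h23]),
    Finset.sum_singleton, hc1, hc2, hc3, chartExponent_fin_two, chartExponent_fin_two,
    chartExponent_fin_two, ← X_pow_mul_X_pow, ← X_pow_mul_X_pow, ← X_pow_mul_X_pow]
  ring

/-- **The translation `u ↦ u + 1` gives `F` back** (characteristic `2`):
`(u+1)²y + y + (u+1)²y³ = u²y + y³ + u²y³ + 2(uy + y + uy³)`.  [OURS · L1 W4.6] -/
theorem pointTransform_fixed [CharP K 2] :
    pointTransform 2 1 ![(1 : K), 0] (State.mk (fixedF K) fixedMult) = fixedF K := by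
  have h2 : (2 : MvPolynomial (Fin 2) K) = 0 := by
    have := CharP.cast_eq_zero (MvPolynomial (Fin 2) K) 2
    exact_mod_cast this
  simp only [pointTransform, translate, chartTransform_fixedF, map_add, map_mul, map_pow, aeval_X,
    Matrix.cons_val_zero, Matrix.cons_val_one, map_one, map_zero, add_zero]
  unfold fixedF
  linear_combination (X 0 * X 1 + X 1 + X 0 * X 1 ^ 3) * h2

variable [DecidableEq K]

/-- **The new multiplicities are the old ones**: `{u = 0}` (multiplicity `0`) is left, `{y = 0}` gets
`ord₀ F − 2 = 1`: `r' = (0, 1) = r`. [OURS · L1 W4.6] -/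
theorem newMult_fixed : newMult 2 1 ![(1 : K), 0] (State.mk (fixedF K) fixedMult) = fixedMult := by
  rw [newMult_eq 2 1 _ (by simp) _ (ordZero_fixedF K)]
  ext i
  fin_cases i <;> simp [fixedMult]

/-- **THE FIXED POINT: one step of the model at the point `u = 1` of the `y`-chart returns the same
state.**  [OURS · L1 W4.6] -/
theorem step_fixedPoint [CharP K 2] :
    step 2 1 ![(1 : K), 0] (State.mk (fixedF K) fixedMult) = State.mk (fixedF K) fixedMult := by
  show State.mk (deletePthPowers 2 (pointTransform 2 1 ![(1 : K), 0] (State.mk (fixedF K) fixedMult)))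
      (newMult 2 1 ![(1 : K), 0] (State.mk (fixedF K) fixedMult)) = _
  rw [pointTransform_fixed, deletePthPowers_fixedF, newMult_fixed]

/-- **The point is equimultiple**: the transform `F` has no monomial of degree `1`. [OURS · L1 W4.6] -/
theorem isEquimultiplePoint_fixed [CharP K 2] :
    IsEquimultiplePoint 2 1 ![(1 : K), 0] (State.mk (fixedF K) fixedMult) := by
  intro d _ hdeg
  rw [pointTransform_fixed]
  by_contra h
  have h3 := ordZero_le_of_coeff_ne_zero (fixedF K) d h
  rw [ordZero_fixedF K] at h3
  have : (3 : ℕ) ≤ d.degree := by exact_mod_cast h3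
  omega

/-- The shade stalls at the fixed point (`2 ↦ 2`), as it must inside the window. [OURS · L1 W4.6] -/
theorem shadeStalls_fixed [CharP K 2] :
    ShadeStalls 2 1 ![(1 : K), 0] (State.mk (fixedF K) fixedMult) := by
  unfold ShadeStalls
  rw [step_fixedPoint]

omit [DecidableEq K] in
/-- **No coordinate curve is a permissible centre**: both `{x = u = 0}` and `{x = y = 0}` have
`ord_C F < 2` (`u`-orders `2, 0, 2`; `y`-orders `1, 3, 3`), so the only permissible coordinate centre of
the model is the point — whose blow-up cycles.  (The `2`-fold locus of `x² + F` is the non-coordinate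
curve `u + y + uy = 0`.)  [OURS · L1 W4.6] -/
theorem ordAlong_axis_lt (i : Fin 2) : CentreBlowup.ordAlong {i} (fixedF K) < 2 := by
  classical
  obtain ⟨h12, h13, h23⟩ := e_ne
  unfold CentreBlowup.ordAlong
  fin_cases i
  · have hmem : e03 ∈ (fixedF K).support := by rw [support_fixedF]; simp
    refine lt_of_le_of_lt (Finset.inf_le hmem) ?_
    simp [CentreBlowup.degIn]
  · have hmem : e21 ∈ (fixedF K).support := by rw [support_fixedF]; simp
    refine lt_of_le_of_lt (Finset.inf_le hmem) ?_
    simp [CentreBlowup.degIn]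

/-- **[OURS · L1 W4.6] A fixed point inside the Moh window (summary).**  Over every field of
characteristic `2` there is a cleaned state `(F, r)` of `x² + F(u, y)` with `y^r ∣ F`, of order `3`
(inside the window `[2, 4)`) and shade `2`, and an equimultiple point of a chart of the blow-up of the
origin at which the step of the model returns `(F, r)` itself.  NOT a statement of the manuscript.
[folklore] -/
theorem exists_fixed_point_in_window (K : Type*) [Field K] [CharP K 2] [DecidableEq K] :
    ∃ (s : State (Fin 2) K) (j : Fin 2) (b : Fin 2 → K), b j = 0 ∧ deletePthPowers 2 s.F = s.F ∧
      (∀ d ∈ s.F.support, s.r ≤ d) ∧ ordZero s.F = 3 ∧ s.shade = 2 ∧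
      IsEquimultiplePoint 2 j b s ∧ step 2 j b s = s :=
  ⟨State.mk (fixedF K) fixedMult, 1, ![1, 0], by simp, deletePthPowers_fixedF K,
    fixedMult_le_of_mem_support K, ordZero_fixedF K, shade_fixed K, isEquimultiplePoint_fixed K,
    step_fixedPoint K⟩

/-- **[OURS · L1 W4.6] An infinite walk of equimultiple point blow-ups INSIDE the window.**  The constant
sequence at the fixed point satisfies every hypothesis of desk #35's `CampaignW46MohWindowShadeAntitone`
with `N` arbitrary: cleaned start with `y^r ∣ F` and `ord₀ F ≥ 2`, each state the step of the previous
one at an equimultiple point of the new exceptional divisor, every state of order `3 < 2p`.  So the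
no-increase law is inhabited by infinite walks, and no termination statement holds for arbitrary
equimultiple point sequences inside the window in the classical model.  NOT a statement of the
manuscript. [folklore] -/
theorem exists_infinite_walk_in_window (K : Type*) [Field K] [CharP K 2] [DecidableEq K] :
    ∃ (s : ℕ → State (Fin 2) K) (j : ℕ → Fin 2) (b : ℕ → Fin 2 → K),
      (∀ n, b n (j n) = 0) ∧ (∀ n, s (n + 1) = step 2 (j n) (b n) (s n)) ∧
      deletePthPowers 2 (s 0).F = (s 0).F ∧ (∀ d ∈ (s 0).F.support, (s 0).r ≤ d) ∧
      ((2 : ℕ) : ℕ∞) ≤ ordZero (s 0).F ∧ (∀ n, IsEquimultiplePoint 2 (j n) (b n) (s n)) ∧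
      (∀ n, ordZero (s n).F < (2 * 2 : ℕ)) ∧ (∀ n, (s n).shade = 2) := by
  refine ⟨fun _ => State.mk (fixedF K) fixedMult, fun _ => 1, fun _ => ![1, 0], fun _ => by simp,
    fun _ => (step_fixedPoint K).symm, deletePthPowers_fixedF K, fixedMult_le_of_mem_support K, ?_,
    fun _ => isEquimultiplePoint_fixed K, fun _ => ?_, fun _ => shade_fixed K⟩
  · rw [ordZero_fixedF]; exact_mod_cast (show (2 : ℕ) ≤ 3 by norm_num)
  · show ordZero (fixedF K) < (2 * 2 : ℕ)
    rw [ordZero_fixedF]; exact_mod_cast (show (3 : ℕ) < 4 by norm_num)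

end Summit.ResolutionOfSingularities.ResolutionOfSingularities.Theorems.CampaignW46.MohWindowShadeFixedPoint
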